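import Literature.AlgebraicGeometry.Resolution.NearPointsPointCentreLineGlobal
import Literature.AlgebraicGeometry.Resolution.NearChainStep
import HarnessLib

/-!
# Cossart–Piltant 2008, Prop. 4.4 — the T1 line: after a POINT step the next curve centre is the line `(y′, φ u)` (stalk form)

OURS (res-inputs-p-8b g2; the slot `stub_lineCentre` of the T1 skeleton v1 695147237e3deab7 = the ring CONTRACT's clause `hPsucc_pt`).
Stalk-level packaging of res-inputs-p-5a's core theorem `IsBlowup.stalkIdeal_vanishingIdeal_closure_eq_span_lineGerm` (p623553): for the
blow-up `π` of a closed point `x` of a regular `X` with `ord_x J = μ`, `τ_x = 1`, embedding dimension `3`, a near point `x′` over `x`, an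
ADAPTED regular system `c = (y, u, w)` of `𝒪_{X,x}` (adapted off the index `0`) lying in the `u`-chart at `x′` (`𝔪_x 𝒪_{x′} = (φ u)`,
`φ y = φ u · y′`, `(φ u, y′)` part of a regular system of `𝒪_{x′}`), and a NON-CLOSED near point `η′` over `x` specialising to `x′`:
`𝓘_{cl η′, x′} = (y′, φ u)`. The label is turned into sections over a common open (as in `exists_adapted_sections`) and the germs are
identified through `Scheme.Hom.germ_stalkMap_apply`; `…_congr` transports to a point `q = x′` (`stalkMapCongr`) for chain bookkeeping.
No new definitions. F-71 / resolution in dim ≥ 4 or char p NOT proved here.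
-/

noncomputable section

open CategoryTheory AlgebraicGeometry TopologicalSpace IsLocalRing
open Literature.AlgebraicGeometry.Resolution Scheme.IdealSheafData

namespace Summit.ResolutionOfSingularities.ResolutionOfSingularities.Theorems

namespace CP2008Prop44

universe u

variable {X X' : Scheme.{u}} {π : X' ⟶ X}

set_option maxHeartbeats 800000 in
/-- **The line centre at the stalk.** For an adapted regular system `c` of `𝒪_{X, π x′}` (point blow-up, `τ = 1`) with `x′` in the `u`-chart
(`𝔪 𝒪_{x′} = (φ (c 1))`, `φ (c 0) = φ (c 1) · y′`, `(φ (c 1), y′)` an rsop pair) and a non-closed near point `η′ ⤳ x′` over `π x′`: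
`𝓘_{cl η′, x′} = (y′, φ (c 1))`. [cite: CossartPiltant2008, Lemma 4.3 (5); Prop. 4.4 (proof, p. 11)] -/
theorem stalkIdeal_vanishingIdeal_closure_eq_span_pair_of_adapted [IsLocallyNoetherian X] [IsLocallyNoetherian X']
    (hX : Scheme.IsRegular X) {x' : X'} (hcl : IsClosed ({π x'} : Set X)) (hπ : IsBlowup π (vanishingIdeal ⟨{π x'}, hcl⟩))
    {J : X.IdealSheafData} {μ : ℕ} (hord : idealOrder J (π x') = μ)
    (hd : (maximalIdeal (X.presheaf.stalk (π x'))).spanFinrank = 3) (hτ : haveI := hX (π x'); stalkTau J (π x') μ = 1)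
    {c : Fin 3 → X.presheaf.stalk (π x')} (hc : Ideal.span (Set.range c) = maximalIdeal _)
    (had : haveI := hX (π x'); ∀ i, i ≠ 0 → IsAdapted c (stalkIdeal J (π x')) μ i)
    (hchart : (maximalIdeal (X.presheaf.stalk (π x'))).map (π.stalkMap x').hom = Ideal.span {(π.stalkMap x').hom (c 1)})
    {y' : X'.presheaf.stalk x'} (hrel : (π.stalkMap x').hom (c 0) = (π.stalkMap x').hom (c 1) * y')
    (hrsop : IsRsopPart ![(π.stalkMap x').hom (c 1), y'])
    {η' : X'} (hη : π η' = π x') (hnear : IsNear π (vanishingIdeal ⟨{π x'}, hcl⟩) J μ η') (hηcl : ¬ IsClosed ({η'} : Set X'))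
    (hsp : η' ⤳ x') :
    stalkIdeal (vanishingIdeal (⟨closure {η'}, isClosed_closure⟩ : Closeds X')) x' = Ideal.span {y', (π.stalkMap x').hom (c 1)} := by
  classical
  haveI hRx : IsRegularLocalRing (X.presheaf.stalk (π x')) := hX (π x')
  -- the label as germs of sections over a common open `U ∋ π x′`
  obtain ⟨U, hxU, g, hg⟩ : ∃ (U : X.Opens) (hxU : π x' ∈ U) (g : Fin 3 → Γ(X, U)),
      ∀ i, X.presheaf.germ U (π x') hxU (g i) = c i := by
    choose U hxU t ht using fun i => X.presheaf.exists_germ_eq (c i)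
    have hle : ∀ i : Fin 3, U 0 ⊓ U 1 ⊓ U 2 ≤ U i := by
      intro i
      fin_cases i
      · exact inf_le_left.trans inf_le_left
      · exact inf_le_left.trans inf_le_right
      · exact inf_le_right
    refine ⟨U 0 ⊓ U 1 ⊓ U 2, Opens.mem_inf.mpr ⟨Opens.mem_inf.mpr ⟨hxU 0, hxU 1⟩, hxU 2⟩,
      fun i => X.presheaf.map (homOfLE (hle i)).op (t i), fun i => ?_⟩
    rw [TopCat.Presheaf.germ_res_apply]
    exact ht i
  have hfun : (fun i => X.presheaf.germ U (π x') hxU (g i)) = c := funext hg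
  have hcg : Ideal.span (Set.range fun i => X.presheaf.germ U (π x') hxU (g i)) = maximalIdeal _ := by rw [hfun]; exact hc
  have hadg : ∀ i, i ≠ (0 : Fin 3) → IsAdapted (fun i => X.presheaf.germ U (π x') hxU (g i)) (stalkIdeal J (π x')) μ i := by
    rw [hfun]; exact had
  have hyU : x' ∈ π ⁻¹ᵁ U := hxU
  -- germs of the pulled-back sections are the images of the label
  have hgerm : ∀ i, X'.presheaf.germ (π ⁻¹ᵁ U) x' hyU (π.app U (g i)) = (π.stalkMap x').hom (c i) := by
    intro i
    rw [← hg i]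
    exact (Scheme.Hom.germ_stalkMap_apply π U x' hxU (g i)).symm
  have hmap_y : (maximalIdeal (X.presheaf.stalk (π x'))).map (π.stalkMap x').hom =
      Ideal.span {X'.presheaf.germ (π ⁻¹ᵁ U) x' hyU (π.app U (g 1))} := by rw [hgerm]; exact hchart
  have hrel_y : X'.presheaf.germ (π ⁻¹ᵁ U) x' hyU (π.app U (g 0)) = X'.presheaf.germ (π ⁻¹ᵁ U) x' hyU (π.app U (g 1)) * y' := by
    rw [hgerm, hgerm]; exact hrel
  have hrsop_y : IsRsopPart ![X'.presheaf.germ (π ⁻¹ᵁ U) x' hyU (π.app U (g 1)), y'] := by rw [hgerm]; exact hrsop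
  have h := hπ.stalkIdeal_vanishingIdeal_closure_eq_span_lineGerm hX hcl hord hd hτ hxU g hcg 0 hadg (y := x') rfl (j := 1) hyU
    hmap_y hrel_y hrsop_y hη hnear hηcl hsp
  rw [h, hgerm]
  -- `Set.range ![a, b] = {a, b}` and reorder
  have hrange : Set.range ![(π.stalkMap x').hom (c 1), y'] = {(π.stalkMap x').hom (c 1), y'} := by
    ext t
    simp only [Set.mem_range, Set.mem_insert_iff, Set.mem_singleton_iff]
    constructor
    · rintro ⟨i, rfl⟩
      fin_cases i
      · exact Or.inl rfl
      · exact Or.inr rfl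
    · rintro (h | h)
      · exact ⟨0, h.symm⟩
      · exact ⟨1, h.symm⟩
  rw [hrange, Set.pair_comm]

/-- The line centre transported to a point `q = x′` (chain bookkeeping via `stalkMapCongr`). [cite: CossartPiltant2008, Lemma 4.3 (5)] -/
theorem stalkIdeal_vanishingIdeal_closure_eq_span_pair_of_adapted_congr [IsLocallyNoetherian X] [IsLocallyNoetherian X']
    (hX : Scheme.IsRegular X) {x' : X'} (hcl : IsClosed ({π x'} : Set X)) (hπ : IsBlowup π (vanishingIdeal ⟨{π x'}, hcl⟩))
    {J : X.IdealSheafData} {μ : ℕ} (hord : idealOrder J (π x') = μ)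
    (hd : (maximalIdeal (X.presheaf.stalk (π x'))).spanFinrank = 3) (hτ : haveI := hX (π x'); stalkTau J (π x') μ = 1)
    {c : Fin 3 → X.presheaf.stalk (π x')} (hc : Ideal.span (Set.range c) = maximalIdeal _)
    (had : haveI := hX (π x'); ∀ i, i ≠ 0 → IsAdapted c (stalkIdeal J (π x')) μ i) (q : X') (h : q = x')
    (hchart : (maximalIdeal (X.presheaf.stalk (π x'))).map (stalkMapCongr π x' q h) = Ideal.span {stalkMapCongr π x' q h (c 1)})
    {y' : X'.presheaf.stalk q} (hrel : stalkMapCongr π x' q h (c 0) = stalkMapCongr π x' q h (c 1) * y')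
    (hrsop : IsRsopPart ![stalkMapCongr π x' q h (c 1), y'])
    {η' : X'} (hη : π η' = π x') (hnear : IsNear π (vanishingIdeal ⟨{π x'}, hcl⟩) J μ η') (hηcl : ¬ IsClosed ({η'} : Set X'))
    (hsp : η' ⤳ q) :
    stalkIdeal (vanishingIdeal (⟨closure {η'}, isClosed_closure⟩ : Closeds X')) q = Ideal.span {y', stalkMapCongr π x' q h (c 1)} := by
  subst h
  simp only [stalkMapCongr_self] at hchart hrel hrsop ⊢
  exact stalkIdeal_vanishingIdeal_closure_eq_span_pair_of_adapted hX hcl hπ hord hd hτ hc had hchart hrel hrsop hη hnear hηcl hsp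

end CP2008Prop44

end Summit.ResolutionOfSingularities.ResolutionOfSingularities.Theorems

end
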